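import Mathlib
import Literature.Computability.AlgebraicComplexity.BCGPUInfiniteGroups

/-!
# A packing bound for TPP designs with commuting quotients: `|X||Y||Z| ≤ dim V`

Setting of Blasiak–Cohn–Grochow–Pratt–Umans (arXiv:2410.14905), Def. 2.1 / Thm. 2.2: a group `G`,
finite `X, Y, Z ⊆ G` with the TPP (embedding form `x y⁻¹ y' z⁻¹ = x' z'⁻¹ ⟹ x = x', y = y', z = z'`,
as in the tree's proved `BCGPU2024_thm_2_2_corrected`), and a separating family
(`IsSeparatingFamily`, tree) whose members lie in a finite-dimensional space `V` of functions
`G → ℂ`. Thm. 2.2 bounds `(|X||Y||Z|)^{ω/3} ≤ ∑ (dim ρ)^ω` when `V = RepFun(R_sep)`.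

**New here (soloist, not in the source).** If `V` is invariant under LEFT translations and the
quotients of `X` commute with the quotients of `Y` (`(x⁻¹x')(y⁻¹y') = (y⁻¹y')(x⁻¹x')`), then

  `|X| · |Y| · |Z| ≤ dim V`                                   (`card_mul_le_finrank_of_comm`)

— the `|X||Y||Z|` test functions `g ↦ f_{xz}(x₀ y⁻¹ y₀ x₀⁻¹ g)` are linearly independent in `V`,
being dual to the points `x' y₀⁻¹ y' z'⁻¹`. This is the exact analogue, for BCGPU's truncated
function spaces, of the Cohn–Umans observation that abelian groups prove nothing
(`|X||Y||Z| ≤ |G| = dim ℂ[G]`); it covers abelian `G` (`card_mul_le_finrank_of_commGroup`), central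
`Y` (`card_mul_le_finrank_of_center`), and `X, Y` inside a common abelian subgroup. With
`V = RepFun(ρ_i)` (left-invariant, `dim ≤ ∑ n_i²`: `repFun_left_invariant`, `finrank_repFun_le`) it
reads `|X||Y||Z| ≤ ∑ n_i²` (`card_mul_le_sum_sq_of_comm`) — compare Thm. 2.2's `∑ n_i^ω` on the
`ω/3`-power.

**Consequence for the fixed-group door at `GL₂(ℂ)`** (sibling file `SoloInformedGLTwoDoor.lean`:
degree-`s` designs of volume `s^{3a}` give `ω ≤ 2/(a−1)`; the trivial level is `3a = 4`). For every
commuting-quotient design at degree `s` the volume is at most `∑ n_i² ≤ C(s+4,4) = dim ℂ[M₂]_{≤s}`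
(`glTwo_comm_volume_le`), hence `3a ≤ 4` (`glTwo_comm_designs_level_le`): such designs — in
particular the whole linearised / infinitesimal (abelian Lie algebra) regime, central `Y`, and
torus designs — can never take the `GL₂` door past its trivial level `ω ≤ 6`. Beating `3a = 4` in
`GL₂(ℂ)` requires the `Y`-quotients to NOT commute with the `X`- and `Z`-quotients (the regime of
the Bruhat-cell `LDU` designs, which also sit at `3a = 4`, and of finite non-abelian subgroups,
which are one-dimensional in `s`); the soloist's conjecture is that `3a = 4` is the ceiling there
too.

References: [BlasiakCohnGrochowPrattUmans2024] arXiv:2410.14905, Def. 2.1, Thm. 2.2, Cor. 2.8,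
§4; H. Cohn, C. Umans, FOCS 2003 (arXiv:math/0307321), Lemma 3.1 ff. (abelian groups).
-/

noncomputable section

open scoped BigOperators
open Module

namespace Summit.MatrixMultiplication.MatrixMultiplication.Theorems

open Literature.Computability.AlgebraicComplexity

variable {G : Type*} [Group G]

/-! ## The abstract packing bound -/

/-- **Commuting-quotient packing bound.** `V` a finite-dimensional space of functions `G → ℂ`
invariant under left translations; `X, Y, Z` a TPP triple (embedding form) with a separating
family (BCGPU Def. 2.1) inside `V`; if the quotients `x⁻¹x'` (`x, x' ∈ X`) commute with the
quotients `y⁻¹y'` (`y, y' ∈ Y`), then `|X||Y||Z| ≤ dim V`. Proof: for `x₀ ∈ X`, `y₀ ∈ Y` the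
functions `t_{xyz} : g ↦ f_{xz}(x₀ y⁻¹ y₀ x₀⁻¹ g)` lie in `V` and satisfy
`t_{xyz}(x' y₀⁻¹ y' z'⁻¹) = [x=x'][y=y'][z=z']`, so they are linearly independent.
[new; cf. BlasiakCohnGrochowPrattUmans2024, Thm. 2.2] -/
theorem card_mul_le_finrank_of_comm (V : Submodule ℂ (G → ℂ)) [FiniteDimensional ℂ V]
    (hV : ∀ φ ∈ V, ∀ h : G, (fun g => φ (h * g)) ∈ V)
    {X Y Z : Finset G}
    (hTPP : ∀ x ∈ X, ∀ x' ∈ X, ∀ y ∈ Y, ∀ y' ∈ Y, ∀ z ∈ Z, ∀ z' ∈ Z,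
      x * y⁻¹ * y' * z⁻¹ = x' * z'⁻¹ → x = x' ∧ y = y' ∧ z = z')
    (f : G → G → (G → ℂ)) (hf : IsSeparatingFamily X Y Z f)
    (hfV : ∀ x ∈ X, ∀ z ∈ Z, f x z ∈ V)
    (hcomm : ∀ x ∈ X, ∀ x' ∈ X, ∀ y ∈ Y, ∀ y' ∈ Y,
      (x⁻¹ * x') * (y⁻¹ * y') = (y⁻¹ * y') * (x⁻¹ * x')) :
    X.card * Y.card * Z.card ≤ finrank ℂ V := by
  classical
  rcases X.eq_empty_or_nonempty with hX | ⟨x₀, hx₀⟩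
  · simp [hX]
  rcases Y.eq_empty_or_nonempty with hY | ⟨y₀, hy₀⟩
  · simp [hY]
  -- index type: the finset `X × Y × Z`
  set I : Finset (G × G × G) := X ×ˢ (Y ×ˢ Z) with hI
  have hmemI : ∀ p ∈ I, p.1 ∈ X ∧ p.2.1 ∈ Y ∧ p.2.2 ∈ Z := fun p hp => by
    simpa [hI, Finset.mem_product] using hp
  -- test functions (as elements of `V`) and evaluation points
  let t : I → V := fun p =>
    ⟨fun g => f p.1.1 p.1.2.2 (x₀ * (p.1.2.1)⁻¹ * y₀ * x₀⁻¹ * g),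
      hV _ (hfV _ (hmemI p.1 p.2).1 _ (hmemI p.1 p.2).2.2) _⟩
  let q : I → G := fun p => p.1.1 * y₀⁻¹ * p.1.2.1 * (p.1.2.2)⁻¹
  -- the duality `t p (q p') = [p = p']`
  have key : ∀ p p' : I, (t p : G → ℂ) (q p') = if p = p' then 1 else 0 := by
    rintro ⟨⟨x, y, z⟩, hp⟩ ⟨⟨x', y', z'⟩, hp'⟩
    obtain ⟨hx, hy, hz⟩ := hmemI _ hp
    obtain ⟨hx', hy', hz'⟩ := hmemI _ hp'
    -- move `y₀` out using the commutation of `x₀⁻¹ x'` with `y⁻¹ y₀`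
    have hc := hcomm x₀ hx₀ x' hx' y hy y₀ hy₀
    have harg : x₀ * y⁻¹ * y₀ * x₀⁻¹ * (x' * y₀⁻¹ * y' * z'⁻¹) = x' * y⁻¹ * y' * z'⁻¹ := by
      calc x₀ * y⁻¹ * y₀ * x₀⁻¹ * (x' * y₀⁻¹ * y' * z'⁻¹)
          = x₀ * ((y⁻¹ * y₀) * (x₀⁻¹ * x')) * (y₀⁻¹ * y' * z'⁻¹) := by group
        _ = x₀ * ((x₀⁻¹ * x') * (y⁻¹ * y₀)) * (y₀⁻¹ * y' * z'⁻¹) := by rw [hc]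
        _ = x' * y⁻¹ * y' * z'⁻¹ := by group
    show f x z (x₀ * y⁻¹ * y₀ * x₀⁻¹ * (x' * y₀⁻¹ * y' * z'⁻¹)) = _
    rw [harg]
    by_cases heq : x' * y⁻¹ * y' * z'⁻¹ = x * z⁻¹
    · obtain ⟨h1, h2, h3⟩ := hTPP x' hx' x hx y hy y' hy' z' hz' z hz heq
      subst h1; subst h2; subst h3
      rw [heq, (hf x' hx' z' hz').1]
      simp
    · rw [(hf x hx z hz).2 x' hx' y hy y' hy' z' hz' heq]
      have hne : (⟨(x, y, z), hp⟩ : I) ≠ ⟨(x', y', z'), hp'⟩ := by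
        intro h
        simp only [Subtype.mk.injEq, Prod.mk.injEq] at h
        obtain ⟨rfl, rfl, rfl⟩ := h
        exact heq (by group)
      simp [hne]
  -- linear independence of `t`
  have hli : LinearIndependent ℂ t := by
    rw [linearIndependent_iff']
    intro S c hc p hp
    have h := congrArg (fun v : V => (v : G → ℂ) (q p)) hc
    simp only [Submodule.coe_sum, Submodule.coe_smul, Finset.sum_apply, Pi.smul_apply,
      smul_eq_mul, Submodule.coe_zero, Pi.zero_apply] at h
    rw [Finset.sum_eq_single p] at h
    · simpa [key] using h
    · intro p' _ hp'
      rw [key p' p]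
      simp [hp']
    · intro hp'
      exact absurd hp hp'
  -- count
  have hcard : Fintype.card I = X.card * Y.card * Z.card := by
    rw [Fintype.card_coe, hI, Finset.card_product, Finset.card_product, mul_assoc]
  rw [← hcard]
  exact hli.fintype_card_le_finrank

/-- Abelian groups: the commutation hypothesis is automatic, so `|X||Y||Z| ≤ dim V` for every
TPP triple with separating functions in a translation-invariant `V` — the truncated analogue of
"abelian groups cannot beat `|X||Y||Z| ≤ |G|`" (Cohn–Umans 2003). [new] -/
theorem card_mul_le_finrank_of_commGroup {A : Type*} [CommGroup A]
    (V : Submodule ℂ (A → ℂ)) [FiniteDimensional ℂ V]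
    (hV : ∀ φ ∈ V, ∀ h : A, (fun g => φ (h * g)) ∈ V)
    {X Y Z : Finset A}
    (hTPP : ∀ x ∈ X, ∀ x' ∈ X, ∀ y ∈ Y, ∀ y' ∈ Y, ∀ z ∈ Z, ∀ z' ∈ Z,
      x * y⁻¹ * y' * z⁻¹ = x' * z'⁻¹ → x = x' ∧ y = y' ∧ z = z')
    (f : A → A → (A → ℂ)) (hf : IsSeparatingFamily X Y Z f)
    (hfV : ∀ x ∈ X, ∀ z ∈ Z, f x z ∈ V) :
    X.card * Y.card * Z.card ≤ finrank ℂ V :=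
  card_mul_le_finrank_of_comm V hV hTPP f hf hfV (fun _ _ _ _ _ _ _ _ => mul_comm _ _)

/-- Central `Y`: if `Y ⊆ Z(G)` then `|X||Y||Z| ≤ dim V`. [new] -/
theorem card_mul_le_finrank_of_center (V : Submodule ℂ (G → ℂ)) [FiniteDimensional ℂ V]
    (hV : ∀ φ ∈ V, ∀ h : G, (fun g => φ (h * g)) ∈ V)
    {X Y Z : Finset G} (hYc : ∀ y ∈ Y, y ∈ Subgroup.center G)
    (hTPP : ∀ x ∈ X, ∀ x' ∈ X, ∀ y ∈ Y, ∀ y' ∈ Y, ∀ z ∈ Z, ∀ z' ∈ Z,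
      x * y⁻¹ * y' * z⁻¹ = x' * z'⁻¹ → x = x' ∧ y = y' ∧ z = z')
    (f : G → G → (G → ℂ)) (hf : IsSeparatingFamily X Y Z f)
    (hfV : ∀ x ∈ X, ∀ z ∈ Z, f x z ∈ V) :
    X.card * Y.card * Z.card ≤ finrank ℂ V := by
  refine card_mul_le_finrank_of_comm V hV hTPP f hf hfV ?_
  intro x _ x' _ y hy y' hy'
  have hyy' : y⁻¹ * y' ∈ Subgroup.center G :=
    Subgroup.mul_mem _ (Subgroup.inv_mem _ (hYc y hy)) (hYc y' hy')
  exact (Subgroup.mem_center_iff.1 hyy') (x⁻¹ * x')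

/-! ## `RepFun` is left-invariant of dimension `≤ ∑ n_i²` -/

/-- `RepFun(ρ_i)` (tree: the span of the matrix coefficients `g ↦ ρ_i(g)_{ab}`) is invariant under
left translation: `ρ_i(hg)_{ab} = ∑_c ρ_i(h)_{ac} ρ_i(g)_{cb}`.
[cite: BlasiakCohnGrochowPrattUmans2024, §2.1 (RepFun)] -/
theorem repFun_left_invariant {ι : Type*} (n : ι → ℕ)
    (ρ : ∀ i, G →* Matrix.GeneralLinearGroup (Fin (n i)) ℂ) :
    ∀ φ ∈ repFun n ρ, ∀ h : G, (fun g => φ (h * g)) ∈ repFun n ρ := by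
  intro φ hφ h
  induction hφ using Submodule.span_induction with
  | mem φ hφ =>
      obtain ⟨i, a, b, rfl⟩ := hφ
      have hexp : (fun g => (fun g' => ((ρ i g' : Matrix (Fin (n i)) (Fin (n i)) ℂ) a b)) (h * g))
          = ∑ c, ((ρ i h : Matrix (Fin (n i)) (Fin (n i)) ℂ) a c) •
              (fun g => ((ρ i g : Matrix (Fin (n i)) (Fin (n i)) ℂ) c b)) := by
        funext g
        rw [Finset.sum_apply]
        simp only [Pi.smul_apply, smul_eq_mul, map_mul, Matrix.GeneralLinearGroup.coe_mul,
          Matrix.mul_apply]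
      rw [hexp]
      exact Submodule.sum_mem _ fun c _ =>
        Submodule.smul_mem _ _ (Submodule.subset_span ⟨i, c, b, rfl⟩)
  | zero =>
      have h0 : (fun g => (0 : G → ℂ) (h * g)) = 0 := rfl
      rw [h0]
      exact Submodule.zero_mem _
  | add φ ψ _ _ hφ hψ =>
      have : (fun g => (φ + ψ) (h * g)) = (fun g => φ (h * g)) + (fun g => ψ (h * g)) := rfl
      rw [this]
      exact Submodule.add_mem _ hφ hψ
  | smul c φ _ hφ =>
      have : (fun g => (c • φ) (h * g)) = c • (fun g => φ (h * g)) := rfl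
      rw [this]
      exact Submodule.smul_mem _ _ hφ

/-- The coefficient functions, indexed by `Σ i, Fin (n i) × Fin (n i)`. -/
private def coeffFun {ι : Type*} (n : ι → ℕ)
    (ρ : ∀ i, G →* Matrix.GeneralLinearGroup (Fin (n i)) ℂ) :
    (Σ i, Fin (n i) × Fin (n i)) → (G → ℂ) :=
  fun iab g => ((ρ iab.1 g : Matrix (Fin (n iab.1)) (Fin (n iab.1)) ℂ) iab.2.1 iab.2.2)

/-- `RepFun` is the span of the range of `coeffFun`. -/
private theorem repFun_eq_span_range {ι : Type*} (n : ι → ℕ)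
    (ρ : ∀ i, G →* Matrix.GeneralLinearGroup (Fin (n i)) ℂ) :
    repFun n ρ = Submodule.span ℂ (Set.range (coeffFun n ρ)) := by
  unfold repFun
  congr 1
  ext φ
  simp only [Set.mem_setOf_eq, Set.mem_range]
  constructor
  · rintro ⟨i, a, b, rfl⟩
    exact ⟨⟨i, a, b⟩, rfl⟩
  · rintro ⟨⟨i, a, b⟩, rfl⟩
    exact ⟨i, a, b, rfl⟩

/-- `RepFun` of a finite family is finite-dimensional. -/
instance repFun_finite {ι : Type*} [Fintype ι] (n : ι → ℕ)
    (ρ : ∀ i, G →* Matrix.GeneralLinearGroup (Fin (n i)) ℂ) :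
    FiniteDimensional ℂ (repFun n ρ) := by
  rw [repFun_eq_span_range]
  exact FiniteDimensional.span_of_finite ℂ (Set.finite_range _)

/-- `dim RepFun(ρ_i) ≤ ∑ n_i²` (spanned by `∑ n_i²` coefficient functions).
[cite: BlasiakCohnGrochowPrattUmans2024, §2.1] -/
theorem finrank_repFun_le {ι : Type*} [Fintype ι] (n : ι → ℕ)
    (ρ : ∀ i, G →* Matrix.GeneralLinearGroup (Fin (n i)) ℂ) :
    finrank ℂ (repFun n ρ) ≤ ∑ i, n i ^ 2 := by
  classical
  rw [repFun_eq_span_range]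
  calc finrank ℂ (Submodule.span ℂ (Set.range (coeffFun n ρ)))
      ≤ Fintype.card (Σ i, Fin (n i) × Fin (n i)) := finrank_range_le_card _
    _ = ∑ i, n i ^ 2 := by simp [Fintype.card_sigma, Fintype.card_prod, sq]

/-- **`|X||Y||Z| ≤ ∑ n_i²` for commuting-quotient designs with separators in `RepFun(ρ_i)`.**
(BCGPU Thm. 2.2 gives `(|X||Y||Z|)^{ω/3} ≤ ∑ n_i^ω` for all TPP designs; under the commutation
hypothesis the volume itself is bounded by `∑ n_i²`.) [new] -/
theorem card_mul_le_sum_sq_of_comm {ι : Type*} [Fintype ι] (n : ι → ℕ)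
    (ρ : ∀ i, G →* Matrix.GeneralLinearGroup (Fin (n i)) ℂ)
    {X Y Z : Finset G}
    (hTPP : ∀ x ∈ X, ∀ x' ∈ X, ∀ y ∈ Y, ∀ y' ∈ Y, ∀ z ∈ Z, ∀ z' ∈ Z,
      x * y⁻¹ * y' * z⁻¹ = x' * z'⁻¹ → x = x' ∧ y = y' ∧ z = z')
    (f : G → G → (G → ℂ)) (hf : IsSeparatingFamily X Y Z f)
    (hmem : ∀ x ∈ X, ∀ z ∈ Z, f x z ∈ repFun n ρ)
    (hcomm : ∀ x ∈ X, ∀ x' ∈ X, ∀ y ∈ Y, ∀ y' ∈ Y,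
      (x⁻¹ * x') * (y⁻¹ * y') = (y⁻¹ * y') * (x⁻¹ * x')) :
    X.card * Y.card * Z.card ≤ ∑ i, n i ^ 2 :=
  (card_mul_le_finrank_of_comm (repFun n ρ) (repFun_left_invariant n ρ) hTPP f hf hmem
    hcomm).trans (finrank_repFun_le n ρ)

/-! ## Reading at the `GL₂(ℂ)` door -/

/-- `GL₂(ℂ)` (local abbreviation). [folklore] -/
local notation "GL₂" => Matrix.GeneralLinearGroup (Fin 2) ℂ

/-- **Commuting-quotient designs sit at the trivial level of the `GL₂` door.** At separating
degree `s`, with the truncated Peter–Weyl family (`∑ n_i² ≤ C(s+4,4)`, `RepFun ∋` every entry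
polynomial of degree `≤ s` — the explicit hypothesis of `SoloInformedGLTwoDoor.lean`), a TPP
design in `GL₂(ℂ)` whose `X`-quotients commute with its `Y`-quotients has volume
`|X||Y||Z| ≤ C(s+4,4) = dim ℂ[M₂]_{≤ s}` — the volume of the trivial design `Y = {1}`. [new] -/
theorem glTwo_comm_volume_le {s r : ℕ} {n : Fin r → ℕ}
    (ρ : ∀ i, GL₂ →* Matrix.GeneralLinearGroup (Fin (n i)) ℂ)
    (hsum : ∑ i, n i ^ 2 ≤ (s + 4).choose 4)
    (hspan : ∀ p : MvPolynomial (Fin 2 × Fin 2) ℂ, p.totalDegree ≤ s →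
      (fun g : GL₂ => MvPolynomial.eval
        (fun ij : Fin 2 × Fin 2 => (g : Matrix (Fin 2) (Fin 2) ℂ) ij.1 ij.2) p) ∈ repFun n ρ)
    {X Y Z : Finset GL₂}
    (hTPP : ∀ x ∈ X, ∀ x' ∈ X, ∀ y ∈ Y, ∀ y' ∈ Y, ∀ z ∈ Z, ∀ z' ∈ Z,
      x * y⁻¹ * y' * z⁻¹ = x' * z'⁻¹ → x = x' ∧ y = y' ∧ z = z')
    (f : GL₂ → GL₂ → (GL₂ → ℂ)) (hf : IsSeparatingFamily X Y Z f)
    (hdeg : ∀ x ∈ X, ∀ z ∈ Z, ∃ p : MvPolynomial (Fin 2 × Fin 2) ℂ, p.totalDegree ≤ s ∧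
      f x z = fun g : GL₂ => MvPolynomial.eval
        (fun ij : Fin 2 × Fin 2 => (g : Matrix (Fin 2) (Fin 2) ℂ) ij.1 ij.2) p)
    (hcomm : ∀ x ∈ X, ∀ x' ∈ X, ∀ y ∈ Y, ∀ y' ∈ Y,
      (x⁻¹ * x') * (y⁻¹ * y') = (y⁻¹ * y') * (x⁻¹ * x')) :
    X.card * Y.card * Z.card ≤ (s + 4).choose 4 := by
  have hmem : ∀ x ∈ X, ∀ z ∈ Z, f x z ∈ repFun n ρ := fun x hx z hz => by
    obtain ⟨p, hp, hfp⟩ := hdeg x hx z hz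
    rw [hfp]
    exact hspan p hp
  exact (card_mul_le_sum_sq_of_comm n ρ hTPP f hf hmem hcomm).trans hsum

/-- Volume exponent of commuting-quotient designs: if `s ≥ 4` and the volume is at least `s^{3a}`,
then `s^{3a} ≤ (2s)^4`; so for `a > 4/3` such designs exist only for `s ≤ 16^{1/(3a−4)}` — they
realise at most the trivial level `3a = 4` of the `GL₂` door (`ω ≤ 6`), never `ω < 6`. [new] -/
theorem glTwo_comm_designs_level_le {s : ℕ} (hs : 4 ≤ s) {a : ℝ} {X Y Z : Finset GL₂}
    (hvolD : X.card * Y.card * Z.card ≤ (s + 4).choose 4)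
    (hvol : (s : ℝ) ^ (3 * a) ≤ (X.card : ℝ) * Y.card * Z.card) :
    (s : ℝ) ^ (3 * a) ≤ (2 * (s : ℝ)) ^ (4 : ℕ) := by
  have hs' : (4 : ℝ) ≤ s := by exact_mod_cast hs
  have h1 : (X.card : ℝ) * Y.card * Z.card ≤ ((s + 4).choose 4 : ℕ) := by
    exact_mod_cast hvolD
  have h2 : (((s + 4).choose 4 : ℕ) : ℝ) ≤ (((s + 4) ^ 4 : ℕ) : ℝ) := by
    exact_mod_cast Nat.choose_le_pow (s + 4) 4
  have h3 : (((s + 4) ^ 4 : ℕ) : ℝ) ≤ (2 * (s : ℝ)) ^ (4 : ℕ) := by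
    push_cast
    exact pow_le_pow_left₀ (by linarith) (by linarith) 4
  exact hvol.trans (h1.trans (h2.trans h3))

/-- … made explicit: a commuting-quotient design of volume `≥ s^{3a}` within the packing bound
forces `s^{3a-4} ≤ 16` — for `a > 4/3` a bound on the degree `s`. [new] -/
theorem glTwo_comm_designs_bounded_degree {s : ℕ} (hs : 4 ≤ s) {a : ℝ}
    {X Y Z : Finset GL₂}
    (hvolD : X.card * Y.card * Z.card ≤ (s + 4).choose 4)
    (hvol : (s : ℝ) ^ (3 * a) ≤ (X.card : ℝ) * Y.card * Z.card) :
    (s : ℝ) ^ (3 * a - 4) ≤ 16 := by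
  have hspos : (0 : ℝ) < s := by
    have : (4 : ℝ) ≤ s := by exact_mod_cast hs
    linarith
  have h := glTwo_comm_designs_level_le hs hvolD hvol
  have h4 : (2 * (s : ℝ)) ^ (4 : ℕ) = 16 * (s : ℝ) ^ (4 : ℝ) := by
    rw [mul_pow]
    norm_num
  rw [h4] at h
  have hsplit : (s : ℝ) ^ (3 * a) = (s : ℝ) ^ (3 * a - 4) * (s : ℝ) ^ (4 : ℝ) := by
    rw [← Real.rpow_add hspos]
    ring_nf
  rw [hsplit] at h
  exact le_of_mul_le_mul_right h (Real.rpow_pos_of_pos hspos _)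

end Summit.MatrixMultiplication.MatrixMultiplication.Theorems

end
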